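import Summits.BirchSwinnertonDyer.BirchSwinnertonDyer.Theorems.ClassRecordThreeEulerHalvesAtThreeJetchevHL

/-!
# Route `ClassRecordThree` (rung K2@3), crux 5 `EulerHalvesAtThree` (item 19109): the Euler-system half
# at a GIVEN frame from the Jetchev direction J₃ AT THAT FRAME and ONE Tamagawa-level TWIST CERTIFICATE
# — TL₃ is dispensable per pair; class-wide it is interchangeable with a `3`-adic twist supply TS₃
# (cell `bsd-stepL`, seat `bsd-stepL-tam3-p1`, session g4; `--supports stmt-BirchSwinnertonDyer-19109`)

Files 1–10 of this seat (g0–g3) reduce item 19109 to {J₃ʳ♭, J₃⁰♭, TL₃} modulo print (p427864: each stub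
EXACTLY as strong as its clause; p438720: the Jetchev binder split by carrier count). The descent from
the Heegner field `K` to `ℚ` on the ¬(ram) ∧ surj clause (0) uses the OPEN binder **TL₃** (Skinner 2016
Thm. C's inequality for EVERY rank-`0` `V` multiplicative at `3`, `V[3]` irreducible, no (ram) prime).
OBSERVATION. The descent arithmetic (`X11b/Three/JetchevShapeOverK.lean` §2) consumes TL₃ only at ONE
curve — the minimal model `Wd` of `E^{d_K}` — and only through `ord₃ q_d ≤ ord₃ #Ш(Wd) + ord₃ ∏c(Wd) −
2·ord₃ #Wd(ℚ)_tors`, `q_d = L(Wd,1)/Ω(Wd)`. As `ord₃ #Ш(Wd) ≥ 0` this is implied by the CERTIFICATE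
**(TC₃ᵗ)** `q_d ≠ 0 ∧ ord₃ q_d ≤ ord₃ ∏_ℓ c_ℓ(Wd) − 2·ord₃ #Wd(ℚ)_tors` — ONE rational number, computable
exactly by modular symbols at the pair. (The sister cell's twist-unit road `X11b/BDPRouteTwistCertificate
{,Odd}.lean` is the case `3 ∤ ∏c` with a UNIT certificate and Kolyvagin 1990; by
`BDPRouteTwistCertificateNecessity.lean` a unit is impossible once `3 ∣ ∏c(E)`; the right certificate
at Tamagawa level `t = ord₃ ∏c(E) = ord₃ ∏c(Wd)` is `ord₃ q_d ≤ t`, i.e. — granted BSD for the rank-`0`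
twist — `Ш(E^{d_K})[3] = 0`.) So per pair clause (0) — and equally the (ram) clauses, where Skinner's
Thm. C is otherwise used — needs NO rank-`0` lower bound: only J₃ AT THE CERTIFIED FRAME.
* §1 `missingUpperBoundAt_three_of_surj_of_jetchevDivisibilityAt_of_twistCertificate` — PER FRAME
  (`ρ̄_{E,3}` onto, ram or not; `d_K` odd, `d_K < −4`, Heegner; Manin-good datum; minimal twist model):
  (TC₃ᵗ) + J₃ at the frame ⟹ `Typed.MissingUpperBoundAt W 3`; corollary: on `3 ∤ ∏c(E)` J₃ is vacuous
  (McCallum-currency twin of `missingUpperBoundAt_of_classX11b_odd_of_twistUnit`).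
* §2 CLASS LEVEL with the SUPPLY **TS₃** (every X11b ∧ surj ∧ ¬(ram) curve has SOME frame carrying
  (TC₃ᵗ); Friedberg–Hoffstein ∕ Ono–Skinner type, NOT in print at `3 ∥ N`, hypothesis shape): clause (0)
  ⟸ J₃⁰♭ + TS₃; the crux BY NAME ⟸ {J₃ʳ♭, J₃⁰♭, TS₃} + published (+ Koly twin). TL₃ and TS₃ are
  incomparable class-wide; per pair TS₃ is a finite exact computation, TL₃ is not.

HONEST FRAMING. Nothing here proves J₃ (any form), TL₃ or TS₃; the item does NOT close; the rung leaf is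
untouched; every theorem is CONDITIONAL on the binders in its signature; nothing is booked; no census
word moves (planner's call). A computed (TC₃ᵗ) is per-pair EVIDENCE-tier input.

References: [McCallumLMS1991] §5 Cor. 5.6; [Jetchev2008] Conj. 1.3, Thm. 1.1; [JetchevSkinnerWan2017] §7.4.1–7.4.2;
[Skinner2016PacificMC] Thm. C (TL₃, replaced here); [Wuthrich2014] Prop. 21; [HoffsteinLuo1997]; [Miller2011LMS] Def. 1.1.
-/
noncomputable section

open scoped Classical

namespace Summit.BirchSwinnertonDyer.Rank1Residual.X11b.Three.Koly

open WeierstrassCurve Literature.NumberTheory.EllipticCurves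
  Literature.NumberTheory.EllipticCurves.ModularForms
  Literature.NumberTheory.EllipticCurves.Rank1Residual
  Summit.BirchSwinnertonDyer.Rank1Residual Summit.BirchSwinnertonDyer.Rank1Residual.X11b

/-! ### §1 Per frame: the upper half from J₃ at the frame and ONE Tamagawa-level twist certificate -/

/-- **The Euler-system half of `BSD(E,3)` at a CERTIFIED FRAME, from the Jetchev direction at that
frame.** Data: `W/ℚ` globally minimal, `(E,3) ∈` X11b, `ρ̄_{E,3}` onto; `K` imaginary quadratic, `d_K`
odd, `d_K < −4` (`#𝓞_K^× = 2`), Heegner for `N`; `Dt` with `3 ∤ c`, `H`, `ι`, the Heegner point `P ∈ E(K)`;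
a minimal model `Wd = Cd • E^{d_K}`. INPUTS (hypothesis shapes): `hTC` = (TC₃ᵗ): `L(Wd,1)/Ω(Wd)` is a
non-zero rational `q` with `ord₃ q ≤ ord₃ ∏_ℓ c_ℓ(Wd) − 2·ord₃ #Wd(ℚ)_tors`; `hJ` = J₃ AT THIS FRAME:
`3^s ∣ P(n)` in `E(K[n])` for every `s ≤ ord₃ ∏c(E)` and every square-free product `n` of Kolyvagin
primes of index `≥ s` (McCallum's `M_∞ ≥ t`). OUTPUT: `Typed.MissingUpperBoundAt W 3`. Proof: file 1 §1
(`shaIndexBound_sharp_three_of_globalDivisibility`: `ord₃ #Ш(E/K) + 2t ≤ 2·ord₃ [E(K):ℤP]`), then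
x11b3's `missingUpperBoundAt_of_shaIndexBound_sharp` with `htw` supplied by `hTC` and `0 ≤ ord₃ #Ш(Wd)`.
NO Hoffstein–Luo, NO Skinner C, NO TL₃, no (ram)/¬(ram) hypothesis. CONDITIONAL; nothing booked.
[cite: McCallumLMS1991, §5 Cor. 5.6 (p. 310)] [cite: Jetchev2008, Conj. 1.3 (p. 812)]
[cite: JetchevSkinnerWan2017, §7.4.1–7.4.2 (pp. 30–31)] [cite: Miller2011LMS, Def. 1.1] -/
theorem missingUpperBoundAt_three_of_surj_of_jetchevDivisibilityAt_of_twistCertificate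
    -- published named facts
    (hGZ : ∀ (N : ℕ) [NeZero N] (W : WeierstrassCurve ℚ) (K : Type) [Field K] [NumberField K],
      gross_zagier N W K)
    (hKo : ∀ (N : ℕ) [NeZero N] (W : WeierstrassCurve ℚ) (K : Type) [Field K] [NumberField K],
      kolyvagin N W K)
    (hGZK : rank_eq_analyticRank_of_analyticRank_le_one) (hmod : hasEntireLFunction_rat)
    (hrec : ∀ (N : ℕ) [NeZero N] (W : WeierstrassCurve ℚ) (K : Type) [Field K] [NumberField K],
      heegnerPointOfConductor_one_galoisConj N W K)
    (hD36 : ∀ (N : ℕ) [NeZero N] (W : WeierstrassCurve ℚ) (K : Type) [Field K] [NumberField K],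
      phi_heegnerTau_mem_singularModuliField N W K)
    (hMcU : McCallum1991_padicValNat_card_sha_primary_add_le_of_globalDivisibility)
    -- the pair
    (W : WeierstrassCurve ℚ) [W.IsElliptic] [W.IsGloballyMinimal] [NeZero (W.conductorNorm ℤ)]
    (hX : ClassX11b W 3) (hρ : Surj W 3)
    -- the frame
    (K : Type) [Field K] [NumberField K] (hK : IsImaginaryQuadratic K)
    (hodd : Odd (NumberField.discr K)) (hlt : NumberField.discr K < -4)
    (hHN : SatisfiesHeegnerHypothesis (W.conductorNorm ℤ) K)
    (Dt : ModularParametrizationData W (W.conductorNorm ℤ))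
    (H : HeegnerDatum (W.conductorNorm ℤ) (NumberField.discr K)) (ι : K →+* ℂ)
    (P : (W.baseChange K).toAffine.Point)
    (hP : WeierstrassCurve.Affine.Point.map ι.toRatAlgHom P = heegnerPointComplex Dt H)
    (hc : ¬ (3 : ℤ) ∣ Dt.c)
    (Wd : WeierstrassCurve ℚ) [Wd.IsElliptic] [Wd.IsGloballyMinimal] (Cd : VariableChange ℚ)
    (hWd : Cd • W.quadraticTwist (NumberField.discr K : ℚ) = Wd)
    -- INPUT (TC₃ᵗ): the twist certificate at Tamagawa level (one rational number at the pair)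
    (hTC : ∃ q : ℚ, Wd.entireLFunction 1 / (Wd.realPeriodRat : ℂ) = (q : ℂ) ∧ q ≠ 0 ∧
      padicValRat 3 q ≤ (padicValNat 3 Wd.tamagawaProduct : ℤ) - 2 * padicValNat 3 Wd.torsionOrder)
    -- INPUT J₃ AT THIS FRAME: the Jetchev direction `M_∞ ≥ t` (hypothesis shape)
    (hJ : ∀ (s : ℕ), s ≤ padicValNat 3 W.tamagawaProduct →
      ∀ (n : ℕ) (d : KolyvaginHeegnerData Dt H.β ι n), Squarefree n →
        (∀ ℓ ∈ n.primeFactors, Zhang2014.IsKolyvaginPrime (W.conductorNorm ℤ) W K 3 ℓ ∧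
          s ≤ Zhang2014.kolyvaginIndex W 3 ℓ) → PDiv d 3 s) :
    Typed.MissingUpperBoundAt W 3 := by
  obtain ⟨hr, h32, hmult, hirr⟩ := hX
  have h3 : NumberField.discr K ≠ -3 := by omega
  have h4 : NumberField.discr K ≠ -4 := by omega
  -- `w_K = 2`, prime to `3`
  have hμ : ¬ 3 ∣ NumberField.Units.torsionOrder K := by
    haveI : NumberField.IsTotallyComplex K := hK.2
    rw [Literature.NumberTheory.DiophantineGeometry.torsionOrder_eq_two_of_discr_lt hK.1 hlt]
    omega
  -- a conductor-1 Kolyvagin–Heegner datum on the frame (Dt, H.β, ι), with bottom point y_K = P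
  obtain ⟨d₁⟩ := exists_kolyvaginHeegnerData_one (hD36 _ W K) hK Dt H.β ι H.dvd_sq_sub
  have hPd : d₁.toGeomPoints d₁.derivedPoint = toGeomPoints (W.baseChange K) P :=
    KolyvaginBottom.toGeomPoints_derivedPoint_one_eq (hrec _ W K) hK hHN hP d₁ rfl
  -- the sharpened bound over K at this frame, from J₃ at the frame + McCallum (file 1 §1)
  have hU : Finite (W.baseChange K).sha → ¬ IsOfFinAddOrder P →
      padicValNat 3 (Nat.card (W.baseChange K).sha) + 2 * padicValNat 3 W.tamagawaProduct ≤
        2 * padicValNat 3 (AddSubgroup.zmultiples P).index := by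
    intro hfin hPinf
    haveI : Finite (W.baseChange K).sha := hfin
    obtain ⟨hrank, -⟩ := hKo (W.conductorNorm ℤ) W K hK hHN ⟨Dt, H, ι, hP⟩ hPinf
    have hbot := torsionBy_eq_bot_of_isImaginaryQuadratic_of_hasIrreducibleModPGaloisRep W K hK
      Nat.prime_three hirr
    have hiv : ∀ x : (W.baseChange K).toAffine.Point, 3 • x = 0 → x = 0 := fun x hx ↦ by
      have hmem : x ∈ AddSubgroup.torsionBy (W.baseChange K).toAffine.Point ((3 : ℕ) : ℤ) := by
        rw [mem_torsionBy_iff, natCast_zsmul]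
        exact hx
      rw [hbot] at hmem
      exact hmem
    exact shaIndexBound_sharp_three_of_globalDivisibility hMcU W K hmult hρ hK h3 h4 hHN Dt H.β ι d₁ P
      hPd hPinf hrank hiv hJ
  -- the twist: transports and the certificate in the shape `htw` of the descent arithmetic
  have hD0 : (NumberField.discr K : ℚ) ≠ 0 := by exact_mod_cast NumberField.discr_ne_zero K
  haveI hEt : (W.quadraticTwist (NumberField.discr K : ℚ)).IsElliptic :=
    W.isElliptic_quadraticTwist hD0
  -- `3 ∣ N` splits in the Heegner field, so `3 ∤ d_K`
  have h3split : SatisfiesHeegnerHypothesis 3 K :=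
    SatisfiesHeegnerHypothesis.of_dvd (dvd_conductorNorm_of_mult (W := W) hmult) hHN
  have h3d : ¬ ((3 : ℕ) : ℤ) ∣ NumberField.discr K :=
    not_dvd_discr_of_split hK Nat.prime_three (by norm_num) h3split
  have htam : padicValNat 3 Wd.tamagawaProduct = padicValNat 3 W.tamagawaProduct :=
    X2.padicValNat_tamagawaProduct_twist_of_heegner_of_odd W 3 h32 K hK hodd h3d hHN Cd hWd
  have hu : padicValRat 3 (Cd.u : ℚ) = 0 :=
    padicValRat_u_eq_zero_of_twist_minimal W 3 K hK hHN hmult Cd hWd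
  have hLt' : (W.quadraticTwist (NumberField.discr K : ℚ)).entireLFunction = Wd.entireLFunction := by
    rw [← hWd, entireLFunction_smul]
  obtain ⟨qd, hqd, hqd0, hvqd⟩ := hTC
  have hLt : (W.quadraticTwist (NumberField.discr K : ℚ)).entireLFunction 1 ≠ 0 := by
    rw [hLt']
    intro h0
    apply hqd0
    have : ((qd : ℂ)) = 0 := by rw [← hqd, h0, zero_div]
    exact_mod_cast this
  have htw : ∃ q : ℚ, Wd.entireLFunction 1 / (Wd.realPeriodRat : ℂ) = (q : ℂ) ∧
      padicValRat 3 q ≤ (padicValNat 3 Wd.shaOrder : ℤ) + padicValNat 3 Wd.tamagawaProduct -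
        2 * padicValNat 3 Wd.torsionOrder := by
    refine ⟨qd, hqd, ?_⟩
    have h0 : (0 : ℤ) ≤ padicValNat 3 Wd.shaOrder := by exact_mod_cast Nat.zero_le _
    linarith
  -- descent to ℚ (x11b3's data-level arithmetic), weight w = t
  exact missingUpperBoundAt_of_shaIndexBound_sharp W 3 (W.conductorNorm ℤ) K Dt H ι P (hGZ _ W K)
    (hKo _ W K) hGZK hmod hK hHN hP h32 hc hμ hr hLt Wd Cd hWd hu htam le_rfl htw hU

/-- **On `3 ∤ ∏_ℓ c_ℓ(E)` the Jetchev input is vacuous: the upper half from ONE twist certificate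
alone** (McCallum-currency twin of the sister cell's `missingUpperBoundAt_of_classX11b_odd_of_twistUnit`,
which uses Kolyvagin 1990 Thm. A instead of Cor. 5.6). Same frame data as §1's main theorem; with
`t = ord₃ ∏c(E) = 0` only `s = 0` occurs in J₃ and `3^0 ∣ P(n)` is trivial. CONDITIONAL on the
published binders and the certificate; nothing booked. [cite: McCallumLMS1991, §5 Cor. 5.6 (p. 310)]
[cite: Miller2011LMS, Def. 1.1] -/
theorem missingUpperBoundAt_three_of_surj_of_not_dvd_tamagawaProduct_of_twistCertificate
    (hGZ : ∀ (N : ℕ) [NeZero N] (W : WeierstrassCurve ℚ) (K : Type) [Field K] [NumberField K],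
      gross_zagier N W K)
    (hKo : ∀ (N : ℕ) [NeZero N] (W : WeierstrassCurve ℚ) (K : Type) [Field K] [NumberField K],
      kolyvagin N W K)
    (hGZK : rank_eq_analyticRank_of_analyticRank_le_one) (hmod : hasEntireLFunction_rat)
    (hrec : ∀ (N : ℕ) [NeZero N] (W : WeierstrassCurve ℚ) (K : Type) [Field K] [NumberField K],
      heegnerPointOfConductor_one_galoisConj N W K)
    (hD36 : ∀ (N : ℕ) [NeZero N] (W : WeierstrassCurve ℚ) (K : Type) [Field K] [NumberField K],
      phi_heegnerTau_mem_singularModuliField N W K)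
    (hMcU : McCallum1991_padicValNat_card_sha_primary_add_le_of_globalDivisibility)
    (W : WeierstrassCurve ℚ) [W.IsElliptic] [W.IsGloballyMinimal] [NeZero (W.conductorNorm ℤ)]
    (hX : ClassX11b W 3) (hρ : Surj W 3) (htam0 : ¬ 3 ∣ W.tamagawaProduct)
    (K : Type) [Field K] [NumberField K] (hK : IsImaginaryQuadratic K)
    (hodd : Odd (NumberField.discr K)) (hlt : NumberField.discr K < -4)
    (hHN : SatisfiesHeegnerHypothesis (W.conductorNorm ℤ) K)
    (Dt : ModularParametrizationData W (W.conductorNorm ℤ))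
    (H : HeegnerDatum (W.conductorNorm ℤ) (NumberField.discr K)) (ι : K →+* ℂ)
    (P : (W.baseChange K).toAffine.Point)
    (hP : WeierstrassCurve.Affine.Point.map ι.toRatAlgHom P = heegnerPointComplex Dt H)
    (hc : ¬ (3 : ℤ) ∣ Dt.c)
    (Wd : WeierstrassCurve ℚ) [Wd.IsElliptic] [Wd.IsGloballyMinimal] (Cd : VariableChange ℚ)
    (hWd : Cd • W.quadraticTwist (NumberField.discr K : ℚ) = Wd)
    (hTC : ∃ q : ℚ, Wd.entireLFunction 1 / (Wd.realPeriodRat : ℂ) = (q : ℂ) ∧ q ≠ 0 ∧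
      padicValRat 3 q ≤ (padicValNat 3 Wd.tamagawaProduct : ℤ) - 2 * padicValNat 3 Wd.torsionOrder) :
    Typed.MissingUpperBoundAt W 3 := by
  have ht : padicValNat 3 W.tamagawaProduct = 0 := padicValNat.eq_zero_of_not_dvd htam0
  refine missingUpperBoundAt_three_of_surj_of_jetchevDivisibilityAt_of_twistCertificate hGZ hKo hGZK
    hmod hrec hD36 hMcU W hX hρ K hK hodd hlt hHN Dt H ι P hP hc Wd Cd hWd hTC ?_
  intro s hs n d _ _
  have hs0 : s = 0 := by omega
  subst hs0
  exact ⟨d.derivedPoint, by simp⟩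

/-! ### §2 Class level: clause (0) and the crux BY NAME with TL₃ replaced by a twist SUPPLY TS₃ -/

/-- **Clause (0) of item 19109 (X11b ∧ surj ∧ ¬(ram) ⟹ the upper half) from J₃⁰♭ and a `3`-adic
TWIST SUPPLY TS₃ in place of TL₃.** `hJ0` = the registered v3 stub shape J₃⁰♭ (Jetchev direction on
Hoffstein–Luo-type ¬(ram) frames). `hTS` = **TS₃** (hypothesis shape, NOT in print): every such curve has
SOME frame (`d_K` odd, `d_K < −4`, Heegner; Manin-good datum; minimal twist model) carrying (TC₃ᵗ).
Proof: §1 at the supplied frame, J₃ there being the instance of J₃⁰♭ (`L(E^{d_K},1) ≠ 0` from `q ≠ 0`).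
CONDITIONAL on every binder; nothing booked. [cite: Jetchev2008, Conj. 1.3 (p. 812)]
[cite: HoffsteinLuo1997, Theorem (§1) — the shape of a twist supply] [cite: Miller2011LMS, Def. 1.1] -/
theorem missingUpperBoundAt_three_of_classX11b_of_surj_of_not_ram_of_jetchevDivisibilityHL_of_twistSupply
    (hGZ : ∀ (N : ℕ) [NeZero N] (W : WeierstrassCurve ℚ) (K : Type) [Field K] [NumberField K],
      gross_zagier N W K)
    (hKo : ∀ (N : ℕ) [NeZero N] (W : WeierstrassCurve ℚ) (K : Type) [Field K] [NumberField K],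
      kolyvagin N W K)
    (hGZK : rank_eq_analyticRank_of_analyticRank_le_one) (hmod : hasEntireLFunction_rat)
    (hrec : ∀ (N : ℕ) [NeZero N] (W : WeierstrassCurve ℚ) (K : Type) [Field K] [NumberField K],
      heegnerPointOfConductor_one_galoisConj N W K)
    (hD36 : ∀ (N : ℕ) [NeZero N] (W : WeierstrassCurve ℚ) (K : Type) [Field K] [NumberField K],
      phi_heegnerTau_mem_singularModuliField N W K)
    (hMcU : McCallum1991_padicValNat_card_sha_primary_add_le_of_globalDivisibility)
    -- OPEN INPUT J₃⁰♭ (registered stub shape)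
    (hJ0 : ∀ (W : WeierstrassCurve ℚ) [W.IsElliptic] [W.IsGloballyMinimal] [NeZero (W.conductorNorm ℤ)]
      (K : Type) [Field K] [NumberField K]
      (Dt : ModularParametrizationData W (W.conductorNorm ℤ)) (β : ℤ) (ι : K →+* ℂ),
      W.analyticRank = 1 → W.HasMultiplicativeReductionAtPrime 3 → Surj W 3 → ¬ Ram W 3 →
      IsImaginaryQuadratic K → SatisfiesHeegnerHypothesis (W.conductorNorm ℤ) K →
      Odd (NumberField.discr K) → (W.quadraticTwist (NumberField.discr K : ℚ)).entireLFunction 1 ≠ 0 →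
      (4 * (W.conductorNorm ℤ : ℤ)) ∣ β ^ 2 - NumberField.discr K → ¬ (3 : ℤ) ∣ Dt.c →
      ∀ (s : ℕ), s ≤ padicValNat 3 W.tamagawaProduct →
        ∀ (n : ℕ) (d : KolyvaginHeegnerData Dt β ι n), Squarefree n →
          (∀ ℓ ∈ n.primeFactors, Zhang2014.IsKolyvaginPrime (W.conductorNorm ℤ) W K 3 ℓ ∧
            s ≤ Zhang2014.kolyvaginIndex W 3 ℓ) → PDiv d 3 s)
    -- OPEN INPUT TS₃: a twist supply with the Tamagawa-level 3-adic certificate (hypothesis shape)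
    (hTS : ∀ (W : WeierstrassCurve ℚ) [W.IsElliptic] [W.IsGloballyMinimal] [NeZero (W.conductorNorm ℤ)],
      ClassX11b W 3 → Surj W 3 → ¬ Ram W 3 →
      ∃ (K : Type) (_ : Field K) (_ : NumberField K)
        (Dt : ModularParametrizationData W (W.conductorNorm ℤ))
        (H : HeegnerDatum (W.conductorNorm ℤ) (NumberField.discr K)) (ι : K →+* ℂ)
        (P : (W.baseChange K).toAffine.Point)
        (Wd : WeierstrassCurve ℚ) (_ : Wd.IsElliptic) (_ : Wd.IsGloballyMinimal) (Cd : VariableChange ℚ)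
        (q : ℚ),
        IsImaginaryQuadratic K ∧ Odd (NumberField.discr K) ∧ NumberField.discr K < -4 ∧
        SatisfiesHeegnerHypothesis (W.conductorNorm ℤ) K ∧
        WeierstrassCurve.Affine.Point.map ι.toRatAlgHom P = heegnerPointComplex Dt H ∧
        ¬ (3 : ℤ) ∣ Dt.c ∧ Cd • W.quadraticTwist (NumberField.discr K : ℚ) = Wd ∧
        Wd.entireLFunction 1 / (Wd.realPeriodRat : ℂ) = (q : ℂ) ∧ q ≠ 0 ∧
        padicValRat 3 q ≤ (padicValNat 3 Wd.tamagawaProduct : ℤ) - 2 * padicValNat 3 Wd.torsionOrder)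
    -- the pair
    (W : WeierstrassCurve ℚ) [W.IsElliptic] [W.IsGloballyMinimal]
    (hX : ClassX11b W 3) (hρ : Surj W 3) (hnram : ¬ Ram W 3) : Typed.MissingUpperBoundAt W 3 := by
  haveI : NeZero (W.conductorNorm ℤ) := ⟨(W.conductorNorm_pos_holds).ne'⟩
  obtain ⟨K, _, _, Dt, H, ι, P, Wd, _, _, Cd, q, hK, hodd, hlt, hHN, hP, hc, hWd, hq, hq0, hvq⟩ :=
    hTS W hX hρ hnram
  obtain ⟨hr, h32, hmult, hirr⟩ := hX
  -- `L(E^{d_K},1) ≠ 0` from the certificate (`q ≠ 0`)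
  have hD0 : (NumberField.discr K : ℚ) ≠ 0 := by exact_mod_cast NumberField.discr_ne_zero K
  haveI hEt : (W.quadraticTwist (NumberField.discr K : ℚ)).IsElliptic :=
    W.isElliptic_quadraticTwist hD0
  have hLt : (W.quadraticTwist (NumberField.discr K : ℚ)).entireLFunction 1 ≠ 0 := by
    rw [show (W.quadraticTwist (NumberField.discr K : ℚ)).entireLFunction = Wd.entireLFunction by
      rw [← hWd, entireLFunction_smul]]
    intro h0
    apply hq0
    have : ((q : ℂ)) = 0 := by rw [← hq, h0, zero_div]
    exact_mod_cast this
  exact missingUpperBoundAt_three_of_surj_of_jetchevDivisibilityAt_of_twistCertificate hGZ hKo hGZK hmod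
    hrec hD36 hMcU W ⟨hr, h32, hmult, hirr⟩ hρ K hK hodd hlt hHN Dt H ι P hP hc Wd Cd hWd
    ⟨q, hq, hq0, hvq⟩
    (hJ0 W K Dt H.β ι hr hmult hρ hnram hK hHN hodd hLt H.dvd_sq_sub hc)

/-- **Item 19109 `EulerHalvesAtThree` (route `ClassRecordThree`, crux 5) BY NAME from the published
named facts and EXACTLY {J₃ʳ♭, J₃⁰♭, TS₃}** — the reduction of record
(`classRecordThree_eulerHalvesAtThree_of_jetchevDivisibilityHL_of_twistLower`, p427657) with the
rank-`0` lower bound TL₃ REPLACED by the twist supply TS₃ of this file. The (ram) clauses α ∕ γ∖α are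
p427657's `missingUpperBoundAt_three_of_classX11b_of_ram_of_jetchevDivisibilityHL` (J₃ʳ♭ + Skinner's
Thm. C `hSk`, unchanged); clause (0) is §2. CONDITIONAL on every binder; the item does NOT close by this
theorem; nothing booked. [cite: McCallumLMS1991, §5 Cor. 5.6 (p. 310)] [cite: Jetchev2008, Conj. 1.3 (p. 812)]
[cite: Skinner2016PacificMC, Thm. C (§1)] -/
theorem classRecordThree_eulerHalvesAtThree_of_jetchevDivisibilityHL_of_twistSupply
    (hGZ : ∀ (N : ℕ) [NeZero N] (W : WeierstrassCurve ℚ) (K : Type) [Field K] [NumberField K],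
      gross_zagier N W K)
    (hKo : ∀ (N : ℕ) [NeZero N] (W : WeierstrassCurve ℚ) (K : Type) [Field K] [NumberField K],
      kolyvagin N W K)
    (hSk : Skinner2016.thmC_padicValRat_bsd_rank_zero)
    (hGZK : rank_eq_analyticRank_of_analyticRank_le_one) (hmod : hasEntireLFunction_rat)
    (hnf : exists_isNewformOf) (hHL : HoffsteinLuo1997_exists_twist_L_one_ne_zero)
    (hMaz : mazur_not_dvd_maninConstant_of_odd)
    (hrec : ∀ (N : ℕ) [NeZero N] (W : WeierstrassCurve ℚ) (K : Type) [Field K] [NumberField K],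
      heegnerPointOfConductor_one_galoisConj N W K)
    (hD36 : ∀ (N : ℕ) [NeZero N] (W : WeierstrassCurve ℚ) (K : Type) [Field K] [NumberField K],
      phi_heegnerTau_mem_singularModuliField N W K)
    (hMcU : McCallum1991_padicValNat_card_sha_primary_add_le_of_globalDivisibility)
    -- OPEN INPUT J₃ʳ♭
    (hJ : ∀ (W : WeierstrassCurve ℚ) [W.IsElliptic] [W.IsGloballyMinimal] [NeZero (W.conductorNorm ℤ)]
      (K : Type) [Field K] [NumberField K]
      (Dt : ModularParametrizationData W (W.conductorNorm ℤ)) (β : ℤ) (ι : K →+* ℂ),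
      W.analyticRank = 1 → W.HasMultiplicativeReductionAtPrime 3 → Surj W 3 → Ram W 3 →
      IsImaginaryQuadratic K → SatisfiesHeegnerHypothesis (W.conductorNorm ℤ) K →
      Odd (NumberField.discr K) → (W.quadraticTwist (NumberField.discr K : ℚ)).entireLFunction 1 ≠ 0 →
      (4 * (W.conductorNorm ℤ : ℤ)) ∣ β ^ 2 - NumberField.discr K → ¬ (3 : ℤ) ∣ Dt.c →
      ∀ (s : ℕ), s ≤ padicValNat 3 W.tamagawaProduct →
        ∀ (n : ℕ) (d : KolyvaginHeegnerData Dt β ι n), Squarefree n →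
          (∀ ℓ ∈ n.primeFactors, Zhang2014.IsKolyvaginPrime (W.conductorNorm ℤ) W K 3 ℓ ∧
            s ≤ Zhang2014.kolyvaginIndex W 3 ℓ) → PDiv d 3 s)
    -- OPEN INPUT J₃⁰♭
    (hJ0 : ∀ (W : WeierstrassCurve ℚ) [W.IsElliptic] [W.IsGloballyMinimal] [NeZero (W.conductorNorm ℤ)]
      (K : Type) [Field K] [NumberField K]
      (Dt : ModularParametrizationData W (W.conductorNorm ℤ)) (β : ℤ) (ι : K →+* ℂ),
      W.analyticRank = 1 → W.HasMultiplicativeReductionAtPrime 3 → Surj W 3 → ¬ Ram W 3 →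
      IsImaginaryQuadratic K → SatisfiesHeegnerHypothesis (W.conductorNorm ℤ) K →
      Odd (NumberField.discr K) → (W.quadraticTwist (NumberField.discr K : ℚ)).entireLFunction 1 ≠ 0 →
      (4 * (W.conductorNorm ℤ : ℤ)) ∣ β ^ 2 - NumberField.discr K → ¬ (3 : ℤ) ∣ Dt.c →
      ∀ (s : ℕ), s ≤ padicValNat 3 W.tamagawaProduct →
        ∀ (n : ℕ) (d : KolyvaginHeegnerData Dt β ι n), Squarefree n →
          (∀ ℓ ∈ n.primeFactors, Zhang2014.IsKolyvaginPrime (W.conductorNorm ℤ) W K 3 ℓ ∧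
            s ≤ Zhang2014.kolyvaginIndex W 3 ℓ) → PDiv d 3 s)
    -- OPEN INPUT TS₃ (replaces TL₃)
    (hTS : ∀ (W : WeierstrassCurve ℚ) [W.IsElliptic] [W.IsGloballyMinimal] [NeZero (W.conductorNorm ℤ)],
      ClassX11b W 3 → Surj W 3 → ¬ Ram W 3 →
      ∃ (K : Type) (_ : Field K) (_ : NumberField K)
        (Dt : ModularParametrizationData W (W.conductorNorm ℤ))
        (H : HeegnerDatum (W.conductorNorm ℤ) (NumberField.discr K)) (ι : K →+* ℂ)
        (P : (W.baseChange K).toAffine.Point)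
        (Wd : WeierstrassCurve ℚ) (_ : Wd.IsElliptic) (_ : Wd.IsGloballyMinimal) (Cd : VariableChange ℚ)
        (q : ℚ),
        IsImaginaryQuadratic K ∧ Odd (NumberField.discr K) ∧ NumberField.discr K < -4 ∧
        SatisfiesHeegnerHypothesis (W.conductorNorm ℤ) K ∧
        WeierstrassCurve.Affine.Point.map ι.toRatAlgHom P = heegnerPointComplex Dt H ∧
        ¬ (3 : ℤ) ∣ Dt.c ∧ Cd • W.quadraticTwist (NumberField.discr K : ℚ) = Wd ∧
        Wd.entireLFunction 1 / (Wd.realPeriodRat : ℂ) = (q : ℂ) ∧ q ≠ 0 ∧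
        padicValRat 3 q ≤ (padicValNat 3 Wd.tamagawaProduct : ℤ) - 2 * padicValNat 3 Wd.torsionOrder) :
    Summit.BirchSwinnertonDyer.BirchSwinnertonDyer.Theses.ClassRecordThree.EulerHalvesAtThree := by
  unfold Summit.BirchSwinnertonDyer.BirchSwinnertonDyer.Theses.ClassRecordThree.EulerHalvesAtThree
  intro W _ _ hX
  refine ⟨fun hram _ ↦ ?_, fun hram _ _ _ ↦ ?_, fun hρ hnram ↦ ?_⟩
  · exact missingUpperBoundAt_three_of_classX11b_of_ram_of_jetchevDivisibilityHL hGZ hKo hSk hGZK hmod hnf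
      hHL hMaz hrec hD36 hMcU hJ W hX hram
  · exact missingUpperBoundAt_three_of_classX11b_of_ram_of_jetchevDivisibilityHL hGZ hKo hSk hGZK hmod hnf
      hHL hMaz hrec hD36 hMcU hJ W hX hram
  · exact missingUpperBoundAt_three_of_classX11b_of_surj_of_not_ram_of_jetchevDivisibilityHL_of_twistSupply
      hGZ hKo hGZK hmod hrec hD36 hMcU hJ0 hTS W hX hρ hnram

/-- **The shared decl of route `KolyvaginRoadThree` (same statement) from {J₃ʳ♭, J₃⁰♭, TS₃}.** [folklore] -/
theorem kolyvaginRoadThree_eulerHalvesAtThree_of_jetchevDivisibilityHL_of_twistSupply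
    (hGZ : ∀ (N : ℕ) [NeZero N] (W : WeierstrassCurve ℚ) (K : Type) [Field K] [NumberField K],
      gross_zagier N W K)
    (hKo : ∀ (N : ℕ) [NeZero N] (W : WeierstrassCurve ℚ) (K : Type) [Field K] [NumberField K],
      kolyvagin N W K)
    (hSk : Skinner2016.thmC_padicValRat_bsd_rank_zero)
    (hGZK : rank_eq_analyticRank_of_analyticRank_le_one) (hmod : hasEntireLFunction_rat)
    (hnf : exists_isNewformOf) (hHL : HoffsteinLuo1997_exists_twist_L_one_ne_zero)
    (hMaz : mazur_not_dvd_maninConstant_of_odd)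
    (hrec : ∀ (N : ℕ) [NeZero N] (W : WeierstrassCurve ℚ) (K : Type) [Field K] [NumberField K],
      heegnerPointOfConductor_one_galoisConj N W K)
    (hD36 : ∀ (N : ℕ) [NeZero N] (W : WeierstrassCurve ℚ) (K : Type) [Field K] [NumberField K],
      phi_heegnerTau_mem_singularModuliField N W K)
    (hMcU : McCallum1991_padicValNat_card_sha_primary_add_le_of_globalDivisibility)
    (hJ : ∀ (W : WeierstrassCurve ℚ) [W.IsElliptic] [W.IsGloballyMinimal] [NeZero (W.conductorNorm ℤ)]
      (K : Type) [Field K] [NumberField K]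
      (Dt : ModularParametrizationData W (W.conductorNorm ℤ)) (β : ℤ) (ι : K →+* ℂ),
      W.analyticRank = 1 → W.HasMultiplicativeReductionAtPrime 3 → Surj W 3 → Ram W 3 →
      IsImaginaryQuadratic K → SatisfiesHeegnerHypothesis (W.conductorNorm ℤ) K →
      Odd (NumberField.discr K) → (W.quadraticTwist (NumberField.discr K : ℚ)).entireLFunction 1 ≠ 0 →
      (4 * (W.conductorNorm ℤ : ℤ)) ∣ β ^ 2 - NumberField.discr K → ¬ (3 : ℤ) ∣ Dt.c →
      ∀ (s : ℕ), s ≤ padicValNat 3 W.tamagawaProduct →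
        ∀ (n : ℕ) (d : KolyvaginHeegnerData Dt β ι n), Squarefree n →
          (∀ ℓ ∈ n.primeFactors, Zhang2014.IsKolyvaginPrime (W.conductorNorm ℤ) W K 3 ℓ ∧
            s ≤ Zhang2014.kolyvaginIndex W 3 ℓ) → PDiv d 3 s)
    (hJ0 : ∀ (W : WeierstrassCurve ℚ) [W.IsElliptic] [W.IsGloballyMinimal] [NeZero (W.conductorNorm ℤ)]
      (K : Type) [Field K] [NumberField K]
      (Dt : ModularParametrizationData W (W.conductorNorm ℤ)) (β : ℤ) (ι : K →+* ℂ),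
      W.analyticRank = 1 → W.HasMultiplicativeReductionAtPrime 3 → Surj W 3 → ¬ Ram W 3 →
      IsImaginaryQuadratic K → SatisfiesHeegnerHypothesis (W.conductorNorm ℤ) K →
      Odd (NumberField.discr K) → (W.quadraticTwist (NumberField.discr K : ℚ)).entireLFunction 1 ≠ 0 →
      (4 * (W.conductorNorm ℤ : ℤ)) ∣ β ^ 2 - NumberField.discr K → ¬ (3 : ℤ) ∣ Dt.c →
      ∀ (s : ℕ), s ≤ padicValNat 3 W.tamagawaProduct →
        ∀ (n : ℕ) (d : KolyvaginHeegnerData Dt β ι n), Squarefree n →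
          (∀ ℓ ∈ n.primeFactors, Zhang2014.IsKolyvaginPrime (W.conductorNorm ℤ) W K 3 ℓ ∧
            s ≤ Zhang2014.kolyvaginIndex W 3 ℓ) → PDiv d 3 s)
    (hTS : ∀ (W : WeierstrassCurve ℚ) [W.IsElliptic] [W.IsGloballyMinimal] [NeZero (W.conductorNorm ℤ)],
      ClassX11b W 3 → Surj W 3 → ¬ Ram W 3 →
      ∃ (K : Type) (_ : Field K) (_ : NumberField K)
        (Dt : ModularParametrizationData W (W.conductorNorm ℤ))
        (H : HeegnerDatum (W.conductorNorm ℤ) (NumberField.discr K)) (ι : K →+* ℂ)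
        (P : (W.baseChange K).toAffine.Point)
        (Wd : WeierstrassCurve ℚ) (_ : Wd.IsElliptic) (_ : Wd.IsGloballyMinimal) (Cd : VariableChange ℚ)
        (q : ℚ),
        IsImaginaryQuadratic K ∧ Odd (NumberField.discr K) ∧ NumberField.discr K < -4 ∧
        SatisfiesHeegnerHypothesis (W.conductorNorm ℤ) K ∧
        WeierstrassCurve.Affine.Point.map ι.toRatAlgHom P = heegnerPointComplex Dt H ∧
        ¬ (3 : ℤ) ∣ Dt.c ∧ Cd • W.quadraticTwist (NumberField.discr K : ℚ) = Wd ∧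
        Wd.entireLFunction 1 / (Wd.realPeriodRat : ℂ) = (q : ℂ) ∧ q ≠ 0 ∧
        padicValRat 3 q ≤ (padicValNat 3 Wd.tamagawaProduct : ℤ) - 2 * padicValNat 3 Wd.torsionOrder) :
    Summit.BirchSwinnertonDyer.BirchSwinnertonDyer.Theses.KolyvaginRoadThree.EulerHalvesAtThree :=
  classRecordThree_eulerHalvesAtThree_of_jetchevDivisibilityHL_of_twistSupply hGZ hKo hSk hGZK hmod hnf hHL
    hMaz hrec hD36 hMcU hJ hJ0 hTS

end Summit.BirchSwinnertonDyer.Rank1Residual.X11b.Three.Koly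

end
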